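import Summits.QuantumFields.YangMills.Theorems.BalabanUVNodesPortS1JacIntGauge

/-!
# NODE O port PT-A — ROW (e) OF `stub_LZjac`: (GI), PART 2 — THE INTEGER FORMULA `Ψ_jac` IS `SL(2,ℂ)`-GAUGE INVARIANT AS A TOTAL FUNCTION (the `IntLocalFormula.isGaugeInv` field): covariance of
# the integer (0.4) model, the UNCONDITIONAL block law `A₁^ℤ(ĉ)(𝐕^u) = Ad^ℂ(u(embZ ĉ₋)) · A₁^ℤ(ĉ)(𝐕) · Ad^ℂ(adj u(b₀(ĉ)₋))` in trace-projected coordinates, and `J_ℤ(ĉ, 𝐔^u) = J_ℤ(ĉ, 𝐔)`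

Cell `ym-nodeO-ideate`, porter seat `ymgap-nodeO-port-PTA-1` (gen 6); `--supports stmt-QuantumFields-27930` (helper); objects ✓ `…PortS1JacPiecesDefs`, two-block locality ✓ `…PortS1JacCover`,
the `2 × 2` adjugate ∕ `su2CoordC` algebra of gen 5 (✓ `…JacobianHoloCov`, `…HoloSL2`, `…HoloGauge`, `…HoloCovBlock`).  [I] = [Balaban1987RG1].  Print: (1.19) p.263 «invariant with respect to
Gᶜ-valued gauge transformations», (1.10) p.262, (2.16) p.269.
WHY UNCONDITIONAL.  `IntFormula.IsGaugeInv` asks invariance for EVERY configuration, junk values included.  Two devices make it hold: (i) `fderiv` is conjugated through LINEAR EQUIVALENCES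
without differentiability hypotheses (`fderiv_conj_of_comp_eq`: the chain rule where differentiable, `0 = 0` where not — differentiability at `w` and at `T w` are equivalent); (ii) the
coordinates are TRACE-PROJECTED (`su2CoordCt`), so conjugation acts on them through `Ad^ℂ` on all of `M₂(ℂ)` (`su2CoordCt_conj_eq_sum`), no tracelessness of the response needed.
PART 1 (✓ `…JacIntGauge`): §1 projected coordinates (`su2CoordCt_conj_eq_sum`), §2 covariance of the integer model (`avgMhZ_gauge`, `iterMhZ_gauge`).  THIS FILE:
* §3 `fderiv_conj_of_comp_eq` [folklore], `exists_winGaugeEquiv`, `exists_conjEquiv`, `avgMhZW_gauge`, `restrictZ_gauge`, `restrictZ_single_gauge`, `inv_eq_adjugate_of_det_eq_one`, `inv_conj_adjugate`,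
  ★★ `jacBlockZ_gauge` (the block law), ★★ `det_jacBlockZ_gauge`, `jacFactorZ_gauge`, ★★★ `jacZ_gauge`.
* §4 `coe_inv_eq_adjugate_of_mem_Gc`, ★★ `isGaugeInv_ΨjacRaw : (ΨjacRaw F Mc k).IsGaugeInv`.
With ✓ `…JacIntLocal.isLocal_ΨjacRaw`: `⟨ΨjacRaw F Mc k, isLocal_ΨjacRaw …, isGaugeInv_ΨjacRaw …⟩ : IntLocalFormula (F.L ^ (k+1) * Mc)` — the Ψ slot of `stub_LZjac`'s residue is INHABITED by the
δ-Jacobian formula; the torus rows and the representation are the next files.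

HONEST FRAMING.  Algebra ∕ calculus over the tree's own (0.4) model; NOTHING of Bałaban's estimates asserted, ported or discharged; `stub_LZjac` OPEN; 27930 OPEN · no claim; K0⁷∕K-Ax OPEN;
NODE O 0∕1; COUNT 8∕28 · K 1∕4 UNMOVED; finite `𝕋⁴_{L^K}` at fixed ε — NOT continuum ∕ OS ∕ Clay; **the Yang–Mills mass gap is NOT proved by any of this.**  No `sorry`, no `def`, no `instance`,
no `notation`; standard axioms.
-/

noncomputable section

open scoped BigOperators Matrix.Norms.L2Operator Topology

namespace Summit.QuantumFields.YangMills.Theorems.BalabanUVNodesPortS1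

open Summit.QuantumFields.YangMills.Theorems.K0RecordFormatNames
open Literature.MathematicalPhysics.QuantumFieldTheory.Balaban1983to89
open Literature.MathematicalPhysics.QuantumFieldTheory.Balaban1983to89.Node00
open Literature.MathematicalPhysics.QuantumFieldTheory.Balaban1983to89.T4Continuum (T4Family Letter LStep loopWord)
open Literature.MathematicalPhysics.QuantumFieldTheory.Balaban1983to89.B7Prop1Explicit (e e_apply disp disp_cons disp_nil disp_replicate Letter.vec_true Letter.vec_false)
open Literature.MathematicalPhysics.QuantumFieldTheory.Balaban1983to89.BlockAveragingZd (IdxZ offZ disp_loopWord)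
open Literature.MathematicalPhysics.QuantumFieldTheory.Balaban1983to89.ExpMeanLog (eml eml_conj)
open Literature.MathematicalPhysics.QuantumLattice (blockMap blockSites mem_blockSites_iff)
open _root_.Matrix
/-! ## §3  The derivative block under the gauge action: the window-space transport, `fderiv` through a linear equivalence, the block law, invariance of the Jacobian factor -/

section Block

variable {d : ℕ}

/-- **`fderiv` CONJUGATED BY LINEAR EQUIVALENCES, unconditionally**: if `G ∘ T = C ∘ G` for continuous linear equivalences `T, C`, then `DG(T w)[T v] = C (DG(w)[v])` — the chain rule where `G` is
differentiable at `w`, and `0 = 0` where it is not (differentiability at `w` and at `T w` are equivalent). [folklore] -/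
theorem fderiv_conj_of_comp_eq {𝕜 : Type*} [NontriviallyNormedField 𝕜] {E F' : Type*} [NormedAddCommGroup E] [NormedSpace 𝕜 E] [NormedAddCommGroup F'] [NormedSpace 𝕜 F']
    (G : E → F') (T : E ≃L[𝕜] E) (C : F' ≃L[𝕜] F') (h : ∀ w, G (T w) = C (G w)) (w v : E) :
    fderiv 𝕜 G (T w) (T v) = C (fderiv 𝕜 G w v) := by
  have hcomp : G ∘ (T : E → E) = (C : F' → F') ∘ G := funext h
  have hback : G = (G ∘ (T : E → E)) ∘ (T.symm : E → E) := by
    funext x; simp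
  by_cases hG : DifferentiableAt 𝕜 G w
  · have hGT : DifferentiableAt 𝕜 G (T w) := by
      have h1 : DifferentiableAt 𝕜 (G ∘ (T : E → E)) (T.symm (T w)) := by
        rw [hcomp, ContinuousLinearEquiv.symm_apply_apply]
        exact C.differentiableAt.comp w hG
      have h2 := h1.comp (T w) T.symm.differentiableAt
      rw [← hback] at h2
      exact h2
    have hchain : fderiv 𝕜 (G ∘ (T : E → E)) w = (fderiv 𝕜 G (T w)).comp (T : E →L[𝕜] E) := by
      rw [fderiv_comp w hGT T.differentiableAt, ContinuousLinearEquiv.fderiv]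
    have hC : fderiv 𝕜 ((C : F' → F') ∘ G) w = (C : F' →L[𝕜] F').comp (fderiv 𝕜 G w) := by
      rw [fderiv_comp w C.differentiableAt hG, ContinuousLinearEquiv.fderiv]
    have := congrArg (fun f : E →L[𝕜] F' => f v) (hchain.symm.trans (by rw [hcomp, hC]))
    simpa using this
  · have hGT : ¬ DifferentiableAt 𝕜 G (T w) := by
      intro hd
      apply hG
      have h1 : DifferentiableAt 𝕜 (G ∘ (T : E → E)) w := hd.comp w T.differentiableAt
      rw [hcomp] at h1
      have h2 := C.symm.differentiableAt.comp w h1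
      have h3 : (C.symm : F' → F') ∘ ((C : F' → F') ∘ G) = G := by funext x; simp
      rwa [h3] at h2
    rw [fderiv_zero_of_not_differentiableAt hG, fderiv_zero_of_not_differentiableAt hGT]
    simp

/-- **The window-space transport** of a det-one integer gauge transformation: a continuous linear AUTOMORPHISM of the configurations on a finite bond set. [cite: Balaban1987RG1, (1.10) p.262 (bookkeeping)] -/
theorem exists_winGaugeEquiv (u : (Fin d → ℤ) → MatA 2) (hu : ∀ z, (u z).det = 1) (S : Finset ((Fin d → ℤ) × Fin d)) :
    ∃ T : (↥S → MatA 2) ≃L[ℂ] (↥S → MatA 2), ∀ (w : ↥S → MatA 2) (b : ↥S), T w b = u b.1.1 * w b * (u (b.1.1 + e b.1.2)).adjugate := by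
  let L₁ : (↥S → MatA 2) →ₗ[ℂ] (↥S → MatA 2) :=
    { toFun := fun w b => u b.1.1 * w b * (u (b.1.1 + e b.1.2)).adjugate
      map_add' := fun w w' => by funext b; simp only [Pi.add_apply, mul_add, add_mul]
      map_smul' := fun z w => by funext b; simp only [Pi.smul_apply, RingHom.id_apply, Matrix.mul_smul, Matrix.smul_mul] }
  let L₂ : (↥S → MatA 2) →ₗ[ℂ] (↥S → MatA 2) :=
    { toFun := fun w b => (u b.1.1).adjugate * w b * u (b.1.1 + e b.1.2)
      map_add' := fun w w' => by funext b; simp only [Pi.add_apply, mul_add, add_mul]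
      map_smul' := fun z w => by funext b; simp only [Pi.smul_apply, RingHom.id_apply, Matrix.mul_smul, Matrix.smul_mul] }
  have h12 : L₁.comp L₂ = LinearMap.id := by
    apply LinearMap.ext; intro w; funext b
    show u b.1.1 * ((u b.1.1).adjugate * w b * u (b.1.1 + e b.1.2)) * (u (b.1.1 + e b.1.2)).adjugate = w b
    calc u b.1.1 * ((u b.1.1).adjugate * w b * u (b.1.1 + e b.1.2)) * (u (b.1.1 + e b.1.2)).adjugate
        = (u b.1.1 * (u b.1.1).adjugate) * w b * (u (b.1.1 + e b.1.2) * (u (b.1.1 + e b.1.2)).adjugate) := by noncomm_ring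
      _ = w b := by rw [self_mul_adjugate_of_det_eq_one (hu _), self_mul_adjugate_of_det_eq_one (hu _), one_mul, mul_one]
  have h21 : L₂.comp L₁ = LinearMap.id := by
    apply LinearMap.ext; intro w; funext b
    show (u b.1.1).adjugate * (u b.1.1 * w b * (u (b.1.1 + e b.1.2)).adjugate) * u (b.1.1 + e b.1.2) = w b
    calc (u b.1.1).adjugate * (u b.1.1 * w b * (u (b.1.1 + e b.1.2)).adjugate) * u (b.1.1 + e b.1.2)
        = ((u b.1.1).adjugate * u b.1.1) * w b * ((u (b.1.1 + e b.1.2)).adjugate * u (b.1.1 + e b.1.2)) := by noncomm_ring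
      _ = w b := by rw [adjugate_mul_self_of_det_eq_one (hu _), adjugate_mul_self_of_det_eq_one (hu _), one_mul, mul_one]
  exact ⟨(LinearEquiv.ofLinear L₁ L₂ h12 h21).toContinuousLinearEquiv, fun w b => rfl⟩

/-- **Conjugation `X ↦ g·X·adj g′`** by det-one matrices as a continuous linear automorphism of `M₂(ℂ)`. [folklore] -/
theorem exists_conjEquiv {g g' : MatA 2} (hg : g.det = 1) (hg' : g'.det = 1) :
    ∃ C : MatA 2 ≃L[ℂ] MatA 2, ∀ X, C X = g * X * g'.adjugate := by
  let L₁ : MatA 2 →ₗ[ℂ] MatA 2 :=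
    { toFun := fun X => g * X * g'.adjugate
      map_add' := fun X Y => by simp only [mul_add, add_mul]
      map_smul' := fun z X => by simp only [RingHom.id_apply, Matrix.mul_smul, Matrix.smul_mul] }
  let L₂ : MatA 2 →ₗ[ℂ] MatA 2 :=
    { toFun := fun X => g.adjugate * X * g'
      map_add' := fun X Y => by simp only [mul_add, add_mul]
      map_smul' := fun z X => by simp only [RingHom.id_apply, Matrix.mul_smul, Matrix.smul_mul] }
  have h12 : L₁.comp L₂ = LinearMap.id := by
    apply LinearMap.ext; intro X
    show g * (g.adjugate * X * g') * g'.adjugate = X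
    calc g * (g.adjugate * X * g') * g'.adjugate = (g * g.adjugate) * X * (g' * g'.adjugate) := by noncomm_ring
      _ = X := by rw [self_mul_adjugate_of_det_eq_one hg, self_mul_adjugate_of_det_eq_one hg', one_mul, mul_one]
  have h21 : L₂.comp L₁ = LinearMap.id := by
    apply LinearMap.ext; intro X
    show g.adjugate * (g * X * g'.adjugate) * g' = X
    calc g.adjugate * (g * X * g'.adjugate) * g' = (g.adjugate * g) * X * (g'.adjugate * g') := by noncomm_ring
      _ = X := by rw [adjugate_mul_self_of_det_eq_one hg, adjugate_mul_self_of_det_eq_one hg', one_mul, mul_one]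
  exact ⟨(LinearEquiv.ofLinear L₁ L₂ h12 h21).toContinuousLinearEquiv, fun X => rfl⟩

/-- **The window-restricted average is covariant under the window-space transport** (integer two-block locality + `avgMhZ_gauge`). [cite: Balaban1987RG1, (0.4) p.253, (1.10) p.262] -/
theorem avgMhZW_gauge {L : ℕ} (hL : 2 * ((L - 1) / 2) + 1 = L) (u : (Fin d → ℤ) → MatA 2) (hu : ∀ z, (u z).det = 1) (ĉ : (Fin d → ℤ) × Fin d)
    (T : (↥(winBondsZ L ĉ) → MatA 2) ≃L[ℂ] (↥(winBondsZ L ĉ) → MatA 2))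
    (hT : ∀ (w : ↥(winBondsZ L ĉ) → MatA 2) (b : ↥(winBondsZ L ĉ)), T w b = u b.1.1 * w b * (u (b.1.1 + e b.1.2)).adjugate) (w : ↥(winBondsZ L ĉ) → MatA 2) :
    avgMhZW L ĉ (T w) = u (embZ L ĉ.1) * avgMhZW L ĉ w * (u (embZ L (ĉ.1 + e ĉ.2))).adjugate := by
  unfold avgMhZW
  rw [← avgMhZ_gauge u hu (extendZ (winBondsZ L ĉ) w) ĉ]
  refine avgMhZ_congr_of_eqOn_winBondsZ hL ĉ fun b hb => ?_
  simp only [extendZ, dif_pos hb]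
  exact hT w ⟨b, hb⟩

/-- The restriction of a transformed configuration is the transport of the restriction. [cite: Balaban1987RG1, (1.10) p.262 (bookkeeping)] -/
theorem restrictZ_gauge {L : ℕ} (u : (Fin d → ℤ) → MatA 2) (ĉ : (Fin d → ℤ) × Fin d) (V : (Fin d → ℤ) × Fin d → MatA 2)
    (T : (↥(winBondsZ L ĉ) → MatA 2) ≃L[ℂ] (↥(winBondsZ L ĉ) → MatA 2))
    (hT : ∀ (w : ↥(winBondsZ L ĉ) → MatA 2) (b : ↥(winBondsZ L ĉ)), T w b = u b.1.1 * w b * (u (b.1.1 + e b.1.2)).adjugate) :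
    restrictZ (winBondsZ L ĉ) (fun b => u b.1 * V b * (u (b.1 + e b.2)).adjugate) = T (restrictZ (winBondsZ L ĉ) V) := by
  funext b
  rw [hT]
  rfl

/-- The restricted single-bond direction of the transformed field is the transport of a rotated single-bond direction: `su2Gen a · u_β V_β adj u_β′ = u_β · (adj u_β su2Gen a u_β · V_β) · adj u_β′`.
[cite: Balaban1987RG1, (2.16) p.269 (bookkeeping)] -/
theorem restrictZ_single_gauge {L : ℕ} (u : (Fin d → ℤ) → MatA 2) (hu : ∀ z, (u z).det = 1) (ĉ : (Fin d → ℤ) × Fin d) (V : (Fin d → ℤ) × Fin d → MatA 2)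
    (T : (↥(winBondsZ L ĉ) → MatA 2) ≃L[ℂ] (↥(winBondsZ L ĉ) → MatA 2))
    (hT : ∀ (w : ↥(winBondsZ L ĉ) → MatA 2) (b : ↥(winBondsZ L ĉ)), T w b = u b.1.1 * w b * (u (b.1.1 + e b.1.2)).adjugate)
    (β : (Fin d → ℤ) × Fin d) (X : MatA 2) :
    restrictZ (winBondsZ L ĉ) (Pi.single β (X * (u β.1 * V β * (u (β.1 + e β.2)).adjugate))) =
      T (restrictZ (winBondsZ L ĉ) (Pi.single β ((u β.1).adjugate * X * u β.1 * V β))) := by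
  classical
  funext b
  rw [hT]
  simp only [restrictZ]
  by_cases hb : b.1 = β
  · rw [hb, Pi.single_eq_same, Pi.single_eq_same]
    calc X * (u β.1 * V β * (u (β.1 + e β.2)).adjugate) = (u β.1 * (u β.1).adjugate) * X * u β.1 * V β * (u (β.1 + e β.2)).adjugate := by
          rw [self_mul_adjugate_of_det_eq_one (hu _), one_mul]; noncomm_ring
      _ = u β.1 * ((u β.1).adjugate * X * u β.1 * V β) * (u (β.1 + e β.2)).adjugate := by noncomm_ring
  · rw [Pi.single_eq_of_ne hb, Pi.single_eq_of_ne hb, mul_zero, zero_mul]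

/-- The inverse of a det-one `2 × 2` matrix is its adjugate. [folklore] -/
theorem inv_eq_adjugate_of_det_eq_one {g : MatA 2} (hg : g.det = 1) : g⁻¹ = g.adjugate :=
  Matrix.inv_eq_left_inv (adjugate_mul_self_of_det_eq_one hg)

/-- `(g · A · adj g′)⁻¹ = g′ · A⁻¹ · adj g` for det-one `g, g′` and ANY `A` (`Matrix.mul_inv_rev` is unconditional). [folklore] -/
theorem inv_conj_adjugate {g g' : MatA 2} (hg : g.det = 1) (hg' : g'.det = 1) (A : MatA 2) : (g * A * g'.adjugate)⁻¹ = g' * A⁻¹ * g.adjugate := by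
  have h1 : (g'.adjugate)⁻¹ = g' := Matrix.inv_eq_left_inv (self_mul_adjugate_of_det_eq_one hg')
  rw [Matrix.mul_inv_rev, Matrix.mul_inv_rev, h1, inv_eq_adjugate_of_det_eq_one hg, mul_assoc]

/-- ★★ **THE INTEGER BLOCK LAW**: `A₁^ℤ(ĉ)(𝐕^u) = Ad^ℂ(u(embZ ĉ₋)) · A₁^ℤ(ĉ)(𝐕) · Ad^ℂ(adj u(b₀(ĉ)₋))` for det-one `u` and EVERY `𝐕` (no smallness: `fderiv` is conjugated through the window transport
unconditionally, the coordinates are trace-projected). [cite: Balaban1987RG1, (2.16) p.269, (1.19) p.263, (1.10) p.262] -/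
theorem jacBlockZ_gauge {L : ℕ} (hL : 2 * ((L - 1) / 2) + 1 = L) (u : (Fin d → ℤ) → MatA 2) (hu : ∀ z, (u z).det = 1) (V : (Fin d → ℤ) × Fin d → MatA 2)
    (ĉ : (Fin d → ℤ) × Fin d) :
    jacBlockZ L ĉ (fun b => u b.1 * V b * (u (b.1 + e b.2)).adjugate) =
      (Matrix.of fun i a : Fin 3 => su2CoordCt (u (embZ L ĉ.1) * su2Gen a * (u (embZ L ĉ.1)).adjugate) i) * jacBlockZ L ĉ V *
        (Matrix.of fun i a : Fin 3 => su2CoordCt ((u (centralBondZ L ĉ).1).adjugate * su2Gen a * ((u (centralBondZ L ĉ).1).adjugate).adjugate) i) := by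
  classical
  obtain ⟨T, hT⟩ := exists_winGaugeEquiv u hu (winBondsZ L ĉ)
  obtain ⟨C, hC⟩ := exists_conjEquiv (hu (embZ L ĉ.1)) (hu (embZ L (ĉ.1 + e ĉ.2)))
  have hGT : ∀ w, avgMhZW L ĉ (T w) = C (avgMhZW L ĉ w) := fun w => by rw [hC, avgMhZW_gauge hL u hu ĉ T hT w]
  -- the rotated directions `Y a = adj u_β · su2Gen a · u_β` are traceless combinations of the generators
  have hYtr : ∀ a : Fin 3, ((u (centralBondZ L ĉ).1).adjugate * su2Gen a * u (centralBondZ L ĉ).1).trace = 0 := fun a =>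
    (trace_adjugate_mul_mul (hu _) _).trans (trace_su2Gen a)
  have hdir : ∀ a : Fin 3, restrictZ (winBondsZ L ĉ) (Pi.single (centralBondZ L ĉ) ((u (centralBondZ L ĉ).1).adjugate * su2Gen a * u (centralBondZ L ĉ).1 * V (centralBondZ L ĉ))) =
      ∑ a', su2CoordCt ((u (centralBondZ L ĉ).1).adjugate * su2Gen a * u (centralBondZ L ĉ).1) a' •
        restrictZ (winBondsZ L ĉ) (Pi.single (centralBondZ L ĉ) (su2Gen a' * V (centralBondZ L ĉ))) := by
    intro a
    have e1 : (u (centralBondZ L ĉ).1).adjugate * su2Gen a * u (centralBondZ L ĉ).1 * V (centralBondZ L ĉ) =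
        ∑ a', su2CoordCt ((u (centralBondZ L ĉ).1).adjugate * su2Gen a * u (centralBondZ L ĉ).1) a' • (su2Gen a' * V (centralBondZ L ĉ)) := by
      conv_lhs => rw [← sum_su2CoordCt_smul_su2Gen (hYtr a)]
      rw [Finset.sum_mul]
      simp_rw [smul_mul_assoc]
    funext b
    simp only [restrictZ, Finset.sum_apply, Pi.smul_apply]
    by_cases hb : b.1 = centralBondZ L ĉ
    · rw [hb, Pi.single_eq_same, e1]
      simp_rw [Pi.single_eq_same]
    · rw [Pi.single_eq_of_ne hb]
      simp_rw [Pi.single_eq_of_ne hb, smul_zero, Finset.sum_const_zero]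
  -- the derivative term under the gauge action
  have hderiv : ∀ a : Fin 3, fderiv ℂ (avgMhZW L ĉ) (restrictZ (winBondsZ L ĉ) (fun b => u b.1 * V b * (u (b.1 + e b.2)).adjugate))
      (restrictZ (winBondsZ L ĉ) (Pi.single (centralBondZ L ĉ) (su2Gen a * (u (centralBondZ L ĉ).1 * V (centralBondZ L ĉ) *
        (u ((centralBondZ L ĉ).1 + e (centralBondZ L ĉ).2)).adjugate)))) =
      C (∑ a', su2CoordCt ((u (centralBondZ L ĉ).1).adjugate * su2Gen a * u (centralBondZ L ĉ).1) a' •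
        fderiv ℂ (avgMhZW L ĉ) (restrictZ (winBondsZ L ĉ) V) (restrictZ (winBondsZ L ĉ) (Pi.single (centralBondZ L ĉ) (su2Gen a' * V (centralBondZ L ĉ))))) := by
    intro a
    rw [restrictZ_gauge u ĉ V T hT, restrictZ_single_gauge u hu ĉ V T hT (centralBondZ L ĉ) (su2Gen a), fderiv_conj_of_comp_eq _ T C hGT, hdir a, map_sum]
    simp_rw [map_smul]
  ext i a
  rw [Matrix.mul_apply]
  simp_rw [Matrix.mul_apply]
  simp only [jacBlockZ, Matrix.of_apply]
  rw [hderiv a, hC, avgMhZ_gauge u hu V ĉ, inv_conj_adjugate (hu _) (hu _)]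
  have hassoc : u (embZ L ĉ.1) * (∑ a', su2CoordCt ((u (centralBondZ L ĉ).1).adjugate * su2Gen a * u (centralBondZ L ĉ).1) a' •
        fderiv ℂ (avgMhZW L ĉ) (restrictZ (winBondsZ L ĉ) V) (restrictZ (winBondsZ L ĉ) (Pi.single (centralBondZ L ĉ) (su2Gen a' * V (centralBondZ L ĉ))))) *
      (u (embZ L (ĉ.1 + e ĉ.2))).adjugate * (u (embZ L (ĉ.1 + e ĉ.2)) * (avgMhZ L V ĉ)⁻¹ * (u (embZ L ĉ.1)).adjugate) =
      u (embZ L ĉ.1) * ((∑ a', su2CoordCt ((u (centralBondZ L ĉ).1).adjugate * su2Gen a * u (centralBondZ L ĉ).1) a' •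
        fderiv ℂ (avgMhZW L ĉ) (restrictZ (winBondsZ L ĉ) V) (restrictZ (winBondsZ L ĉ) (Pi.single (centralBondZ L ĉ) (su2Gen a' * V (centralBondZ L ĉ))))) * (avgMhZ L V ĉ)⁻¹) *
      (u (embZ L ĉ.1)).adjugate := by
    calc _ = u (embZ L ĉ.1) * (∑ a', su2CoordCt ((u (centralBondZ L ĉ).1).adjugate * su2Gen a * u (centralBondZ L ĉ).1) a' •
          fderiv ℂ (avgMhZW L ĉ) (restrictZ (winBondsZ L ĉ) V) (restrictZ (winBondsZ L ĉ) (Pi.single (centralBondZ L ĉ) (su2Gen a' * V (centralBondZ L ĉ))))) *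
          ((u (embZ L (ĉ.1 + e ĉ.2))).adjugate * u (embZ L (ĉ.1 + e ĉ.2))) * (avgMhZ L V ĉ)⁻¹ * (u (embZ L ĉ.1)).adjugate := by noncomm_ring
      _ = _ := by rw [adjugate_mul_self_of_det_eq_one (hu _), mul_one]; noncomm_ring
  rw [hassoc, su2CoordCt_conj_eq_sum (hu _)]
  simp_rw [su2CoordCt_sum_smul_mul, Finset.mul_sum, Finset.sum_mul]
  rw [Finset.sum_comm]
  refine Finset.sum_congr rfl fun a' _ => Finset.sum_congr rfl fun i' _ => ?_
  rw [adjugate_adjugate_two]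
  ring

/-- ★★ **THE DETERMINANT OF THE INTEGER BLOCK IS GAUGE INVARIANT** (both adjoint matrices have determinant one). [cite: Balaban1987RG1, (1.19) p.263, (2.16) p.269] -/
theorem det_jacBlockZ_gauge {L : ℕ} (hL : 2 * ((L - 1) / 2) + 1 = L) (u : (Fin d → ℤ) → MatA 2) (hu : ∀ z, (u z).det = 1) (V : (Fin d → ℤ) × Fin d → MatA 2)
    (ĉ : (Fin d → ℤ) × Fin d) : (jacBlockZ L ĉ (fun b => u b.1 * V b * (u (b.1 + e b.2)).adjugate)).det = (jacBlockZ L ĉ V).det := by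
  have hadj : ((u (centralBondZ L ĉ).1).adjugate).det = 1 := by rw [Matrix.det_adjugate, hu, one_pow]
  rw [jacBlockZ_gauge hL u hu V ĉ, Matrix.det_mul, Matrix.det_mul, det_adMatCt_of_det_eq_one (hu _), det_adMatCt_of_det_eq_one hadj, one_mul, mul_one]

/-- ★★ **The integer Jacobian factor is gauge invariant.** [cite: Balaban1987RG1, (1.19) p.263] -/
theorem jacFactorZ_gauge {L : ℕ} (hL : 2 * ((L - 1) / 2) + 1 = L) (u : (Fin d → ℤ) → MatA 2) (hu : ∀ z, (u z).det = 1) (V : (Fin d → ℤ) × Fin d → MatA 2)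
    (ĉ : (Fin d → ℤ) × Fin d) : jacFactorZ L ĉ (fun b => u b.1 * V b * (u (b.1 + e b.2)).adjugate) = jacFactorZ L ĉ V := by
  rw [jacFactorZ, jacFactorZ, det_jacBlockZ_gauge hL u hu V ĉ]

/-- ★★★ **THE INTEGER JACOBIAN FUNCTIONAL IS GAUGE INVARIANT**: `J_ℤ(ĉ, 𝐔^u) = J_ℤ(ĉ, 𝐔)` for every det-one `u : ℤ^d → M₂(ℂ)` and EVERY fine configuration `𝐔` (iterate covariance + factor invariance).
[cite: Balaban1987RG1, (1.19) p.263 («invariant with respect to Gᶜ-valued gauge transformations»), (1.10) p.262] -/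
theorem jacZ_gauge {L : ℕ} (hL : 2 * ((L - 1) / 2) + 1 = L) (k : ℕ) (u : (Fin d → ℤ) → MatA 2) (hu : ∀ z, (u z).det = 1) (U : (Fin d → ℤ) × Fin d → MatA 2)
    (ĉ : (Fin d → ℤ) × Fin d) : jacZ L k ĉ (fun b => u b.1 * U b * (u (b.1 + e b.2)).adjugate) = jacZ L k ĉ U := by
  unfold jacZ
  rw [iterMhZ_gauge k u hu U]
  exact jacFactorZ_gauge hL (fun z => u ((embZ L)^[k] z)) (fun z => hu _) (iterMhZ L k U) ĉ

end Block

/-! ## §4  ★★ (GI) — `SL(2,ℂ)`-GAUGE INVARIANCE of the integer formula `Ψ_jac` -/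

section GI

/-- The units inverse of an `SL(2,ℂ)` element is its adjugate. [folklore] -/
theorem coe_inv_eq_adjugate_of_mem_Gc {û : (MatA 2)ˣ} (h : û ∈ (B12RegularSpaces111SpecialUnitary.suModel 2).Gc) : ((û⁻¹ : (MatA 2)ˣ) : MatA 2) = (û : MatA 2).adjugate := by
  rw [B12RegularSpaces111SpecialUnitary.mem_suModel_Gc] at h
  rw [Matrix.coe_units_inv, inv_eq_adjugate_of_det_eq_one h]

/-- ★★ **(GI) `SL(2,ℂ)`-GAUGE INVARIANCE OF `Ψ_jac`**: `ΨjacRaw F Mc k X̂ (f^û) = ΨjacRaw F Mc k X̂ f` for every `SL(2,ℂ)`-valued integer gauge function `û` — the `IntLocalFormula.isGaugeInv`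
field ([I] (1.19) «for all Gᶜ-valued gauge transformations u»). [cite: Balaban1987RG1, (1.19) p.263, (1.10) p.262] -/
theorem isGaugeInv_ΨjacRaw (F : T4Family) (Mc k : ℕ) : (ΨjacRaw F Mc k).IsGaugeInv := by
  have hL : 2 * ((F.L - 1) / 2) + 1 = F.L := AveragingRT.two_mul_half_add_one (F.P 0)
  intro Xh û hû f
  show -∑ ĉ ∈ coarseBondsOf Mc Xh, (jacZ F.L k ĉ (fun b => ((û b.1 : MatA 2) * (f b).1 * ((û (Function.update b.1 b.2 (b.1 b.2 + 1)))⁻¹ : (MatA 2)ˣ),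
      (û b.1 : MatA 2) * (f b).2 * ((û b.1)⁻¹ : (MatA 2)ˣ)).1) - jacZ F.L k ĉ 1) =
    -∑ ĉ ∈ coarseBondsOf Mc Xh, (jacZ F.L k ĉ (fun b => (f b).1) - jacZ F.L k ĉ 1)
  refine congrArg Neg.neg (Finset.sum_congr rfl fun ĉ _ => ?_)
  have hdet : ∀ z, ((û z : (MatA 2)ˣ) : MatA 2).det = 1 := fun z => B12RegularSpaces111SpecialUnitary.mem_suModel_Gc.1 (hû z)
  have hcfg : (fun b : (Fin 4 → ℤ) × Fin 4 => ((û b.1 : MatA 2) * (f b).1 * ((û (Function.update b.1 b.2 (b.1 b.2 + 1)))⁻¹ : (MatA 2)ˣ),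
      (û b.1 : MatA 2) * (f b).2 * ((û b.1)⁻¹ : (MatA 2)ˣ)).1) =
      fun b => (û b.1 : MatA 2) * (f b).1 * ((û (b.1 + e b.2) : (MatA 2)ˣ) : MatA 2).adjugate := by
    funext b
    simp only
    rw [update_add_one_eq_add_e, coe_inv_eq_adjugate_of_mem_Gc (hû _)]
  rw [hcfg, jacZ_gauge hL k (fun z => ((û z : (MatA 2)ˣ) : MatA 2)) hdet (fun b => (f b).1) ĉ]

end GI

end Summit.QuantumFields.YangMills.Theorems.BalabanUVNodesPortS1

end
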